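import Summits.QuantumFields.YangMills.Theorems.BalabanUVNodesN07QOfRecordOntoSmallField
import Literature.MathematicalPhysics.QuantumFieldTheory.Balaban1983to89.Node00.LinearisedAveragingCovariantLocal
import Summits.QuantumFields.YangMills.Theorems.BalabanUVNodesK0Stub1RecordAveragingRightInverse
import Literature.MathematicalPhysics.QuantumFieldTheory.Balaban1983to89.B9Eq328GaugeAction
import HarnessLib

/-!
# NODE N07 — [B9] (3.32) «the equalities (3.32) hold again» FOR def-Y's PINNED BOND AVERAGING `Q(U₀) = QOfRecord F N k U₀` (print's (44), the LINEARISED k-FOLD (0.4)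
# AVERAGING OF RECORD): GAUGE COVARIANCE `Q(U₀^u) R(u) = R(ū) Q(U₀)`, `ū = u ∘ embIter k` — the real form `qSkewOp`, its complexification `qCplxOp`, and the slot-typed letter

Cell `pub-ymgap`, width seat `pub-ymgap-dag-n07-w3` (g24), CLAIM-4.  `--kind proof --supports stmt-QuantumFields-27238 --as helper`; count-neutral.
[B9] = [Balaban1985BackgroundPropagators]; [B7] = [Balaban1985Averaging]; [15] = [Balaban1985Variational].

WHY.  Print proves the gauge-transformation law `Δ_a(U^u) = R(u)Δ_a(U)R(u⁻¹)` (3.34) — and with it transfers [B9] Thm 3.11's positivity along gauge orbits — from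
the covariance of every letter, and for the averaging operators only says «inspecting the definitions of the averaging operators Q_j(U) … we can see that the
equalities (3.32) hold again» (p.396).  For the (0.4) average of record the kernel fact is dag-n10-w1's ✓`Node00.dIterL_gaugeAct_velField` (right chart, `𝔰𝔲(N)` directions,
from ✓`B16Sect1Backgrounds.iter_gaugeAct`).  This file is the edition AT def-Y's LETTER (✓p814239: LEFT chart `X·U₀`, right-trivialised, `L^{-k}`-normalised, complexified
from the real form `𝔲(N)` — hence with the `U(1)`-line, dag-n07-e's ✓`N07AveragingPhaseEquivariance.dIterL_phase_eq_flat_mul`), read through the record's carriers.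

WHAT IS PROVED (sorry-free; no definition; axioms standard; `P` a generic torus, `U₀` guarded below `k` (`SmallBelow`), `k ≤ m + K`, `u` any gauge transformation,
`ū = toMS u k = u ∘ embIter k`).
* §1 `leftVel_eq_rightVel` ∕ `leftVel_gaugeAct_eq_rightVel` (SU unitarity via ✓`Node00.coe_mul_star_coe_SU` ∕ `star_coe_mul_coe_SU` ∕ `coe_inv_SU`), ★★ `qSkewOp_gaugeAct_su` — `𝔰𝔲(N)` directions: `qSkewOp k U₀^u (Ad_{u(b₋)}X) c = Ad_{ū(c₋)} (qSkewOp k U₀ X c)` (left chart = right chart at `X′ = Ad_{U₀(b)⁻¹}X`).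
* §2 ★ `qSkewOp_phase` — the `U(1)` line: `qSkewOp k U₀ ((iθ)·1) = qSkewOp k 1 ((iθ)·1)` (background-INDEPENDENT), `conj_qSkewOp_one_phase` (it is fixed by every `SU(N)`
  conjugation: k0-s1-w1 ✓`linFamily_realLinear`).
* §3 ★★ `qSkewOp_gaugeAct_skew` — every skew-Hermitian direction (`𝔲(N) = 𝔰𝔲(N) ⊕ iℝ·1`, dag-n07-e ✓`sub_phase_mem_lieSU`); `skewField_conj`; ★★ `qCplxOp_gaugeAct` —
  the complexified operator:
  `qCplxOp k U₀^u (Ad_{u(b₋)}Z) c = Ad_{ū(c₋)} (qCplxOp k U₀ Z c)` for EVERY matrix field `Z`.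
* §4 ★★★ `QOfRecord_gaugeAct` — AT THE RECORD, in def-Y's slot types: `QOfRecord F N k (u • U₀) (gaugeW phiRec (u ∘ src) x) = gaugeW phiRec (ū ∘ src) (QOfRecord F N k U₀ x)` —
  print's (3.32) `Q(U^u)R(u) = R(ū)Q(U)` for the pinned letter.

HONEST SCOPE.  Lattice calculus over kernel-checked tree identities; under 35b's guard `SmallBelow … k U₀` only (there `dIterL` IS the derivative); nothing of [B7]∕[B9]∕[15]
asserted; no estimate; P0 OPEN; N07 NOT discharged; K0ᴬ∕K1ᴬ∕K3ᴬ OPEN; counts unmoved (28∕28 · 8∕28 · K 1∕4); one finite 𝕋⁴ programme at fixed ε — R4 closes the conditional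
finite-𝕋⁴ rung `BalabanLadder.UV` only, never the summit; nothing continuum ∕ ℝ⁴ ∕ OS; the Yang–Mills mass gap (Clay) is NOT proved by any of this.
No `sorry`, no `def`, no `instance`, no `notation`.

References: [B9] (3.13)–(3.16) p.393, (3.28)–(3.32) pp.395–396; [B7] (8) p.18, (11) p.19; [15] (18) p.281, (44) p.285; [Balaban1987RG1] (0.4) p.253, (0.21) p.256.
-/

set_option autoImplicit false

noncomputable section

open scoped Matrix

namespace Summit.QuantumFields.YangMills.Theorems.N07QOfRecordGaugeCovariance

open Literature.MathematicalPhysics.QuantumFieldTheory.Balaban1983to89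
open Literature.MathematicalPhysics.QuantumFieldTheory.Balaban1983to89.T4Continuum (T4Family)
open T4Continuum BlockAveraging
open ExpMeanLog (expMeanLogSU)
open B9Eq311L2Pairing (WL2)
open T4AdjointCovarianceUnitary (lieSU mem_lieSU_iff specialUnitaryAd coe_specialUnitaryAd)
open B16Sect1Backgrounds (toMS iter_gaugeAct)
open Node00
open Summit.QuantumFields.YangMills.Theorems.N07QOfRecordFlatOnto (qSkewOp_one_apply skewField_conjTranspose)
open Summit.QuantumFields.YangMills.BalabanUVNodes.N07AveragingPhaseEquivariance (dIterL_phase_eq_flat_mul star_phase_smul_one)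
open Summit.QuantumFields.YangMills.Theorems.ChartHInv (exists_linFamily)
open Summit.QuantumFields.YangMills.Theorems.K0Stub1RecordAveragingRightInverse (linFamily_realLinear)
open Summit.QuantumFields.YangMills.BalabanUVNodes.N07QOfRecordOntoSmallField (sub_phase_mem_lieSU)
open GaugeField (gaugeAct)

variable {P : Params} {N : ℕ}

/-! ## §1  `𝔰𝔲(N)` directions: left chart = right chart at the `Ad_{U₀⁻¹}`-rotated direction; dag-n10-w1's covariance -/

/-- **LEFT CHART = RIGHT CHART AT THE ROTATED DIRECTION**: `X·U₀ = U₀·(Ad_{U₀⁻¹}X)` bondwise. [cite: Balaban1985Variational, (18) p.281 (bookkeeping)] -/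
theorem leftVel_eq_rightVel (U₀ : GaugeField P 0 (SU N)) (X : PBond P 0 → lieSU (Fin N)) :
    (fun b : PBond P 0 => (X b : Matrix (Fin N) (Fin N) ℂ) * (U₀ b : Matrix (Fin N) (Fin N) ℂ)) =
      fun b : PBond P 0 => (U₀ b : Matrix (Fin N) (Fin N) ℂ) * ((specialUnitaryAd (U₀ b)⁻¹ (X b) : lieSU (Fin N)) : Matrix (Fin N) (Fin N) ℂ) := by
  funext b
  rw [coe_specialUnitaryAd, coe_inv_SU, star_star, ← mul_assoc, ← mul_assoc, coe_mul_star_coe_SU, one_mul]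

variable [NeZero N]

/-- The gauged left-chart direction `Ad_{u(b₋)}X · U₀^u(b)` is the gauged right-chart one `U₀^u(b) · Ad_{u(b₊)}(Ad_{U₀(b)⁻¹}X)`.
[cite: Balaban1985BackgroundPropagators, (3.28)-(3.29) p.395 (bookkeeping)] -/
theorem leftVel_gaugeAct_eq_rightVel (u : GaugeTransf P 0 (SU N)) (U₀ : GaugeField P 0 (SU N)) (X : PBond P 0 → lieSU (Fin N)) :
    (fun b : PBond P 0 => ((specialUnitaryAd (u b.src) (X b) : lieSU (Fin N)) : Matrix (Fin N) (Fin N) ℂ) * ((gaugeAct u U₀ b : SU N) : Matrix (Fin N) (Fin N) ℂ)) =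
      fun b : PBond P 0 => ((gaugeAct u U₀ b : SU N) : Matrix (Fin N) (Fin N) ℂ) *
        ((specialUnitaryAd (u b.tgt) (specialUnitaryAd (U₀ b)⁻¹ (X b)) : lieSU (Fin N)) : Matrix (Fin N) (Fin N) ℂ) := by
  funext b
  have hg : ((gaugeAct u U₀ b : SU N) : Matrix (Fin N) (Fin N) ℂ) =
      (u b.src : Matrix (Fin N) (Fin N) ℂ) * (U₀ b : Matrix (Fin N) (Fin N) ℂ) * star (u b.tgt : Matrix (Fin N) (Fin N) ℂ) := by
    show ((u b.src * U₀ b * (u b.tgt)⁻¹ : SU N) : Matrix (Fin N) (Fin N) ℂ) = _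
    rw [Submonoid.coe_mul, Submonoid.coe_mul, coe_inv_SU]
  rw [hg, coe_specialUnitaryAd, coe_specialUnitaryAd, coe_specialUnitaryAd, coe_inv_SU, star_star]
  have h1 := star_coe_mul_coe_SU (u b.src)
  have h2 := star_coe_mul_coe_SU (u b.tgt)
  have h3 := coe_mul_star_coe_SU (U₀ b)
  set a : Matrix (Fin N) (Fin N) ℂ := (u b.src : Matrix (Fin N) (Fin N) ℂ)
  set t : Matrix (Fin N) (Fin N) ℂ := (u b.tgt : Matrix (Fin N) (Fin N) ℂ)
  set V : Matrix (Fin N) (Fin N) ℂ := (U₀ b : Matrix (Fin N) (Fin N) ℂ)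
  set Y : Matrix (Fin N) (Fin N) ℂ := (X b : Matrix (Fin N) (Fin N) ℂ)
  trans a * Y * V * star t
  · calc a * Y * star a * (a * V * star t) = a * Y * (star a * a) * V * star t := by noncomm_ring
      _ = a * Y * V * star t := by rw [h1]; noncomm_ring
  · symm
    calc a * V * star t * (t * (star V * Y * V) * star t) = a * (V * (star t * t) * star V) * Y * V * star t := by noncomm_ring
      _ = a * Y * V * star t := by rw [h2, mul_one, h3]; noncomm_ring

/-- ★★ **GAUGE COVARIANCE OF def-Y's REAL-FORM `Q_k(U₀)` ON `𝔰𝔲(N)` DIRECTIONS**: under the guard below `k ≤ m + K`,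
`qSkewOp k U₀^u (b ↦ Ad_{u(b₋)}X_b) c = ū(c₋) · (qSkewOp k U₀ X c) · ū(c₋)⋆`, `ū = u ∘ embIter k` — print's `Q(U^u)R(u) = R(ū)Q(U)` ((3.32)) for the left-chart, right-trivialised
letter (dag-n10-w1's ✓`dIterL_gaugeAct_velField` at the rotated direction + ✓`iter_gaugeAct`). [cite: Balaban1985BackgroundPropagators, (3.32) p.396, (3.13) p.393; Balaban1985Averaging, (11) p.19] -/
theorem qSkewOp_gaugeAct_su {k : ℕ} (hk : k ≤ P.m + P.K) (u : GaugeTransf P 0 (SU N)) {U₀ : GaugeField P 0 (SU N)}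
    (h : SmallBelow (fun j => blockAvg (P := P) (j := j) expMeanLogSU) k U₀) (X : PBond P 0 → lieSU (Fin N)) (c : PBond P k) :
    qSkewOp k (gaugeAct u U₀) (fun b : PBond P 0 => ((specialUnitaryAd (u b.src) (X b) : lieSU (Fin N)) : Matrix (Fin N) (Fin N) ℂ)) c =
      (toMS u k c.src : Matrix (Fin N) (Fin N) ℂ) * qSkewOp k U₀ (fun b : PBond P 0 => (X b : Matrix (Fin N) (Fin N) ℂ)) c *
        star (toMS u k c.src : Matrix (Fin N) (Fin N) ℂ) := by
  have hu := smallBelow_gaugeAct hk u h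
  have hg : ((gaugeAct (toMS u k) (Averaging.iter (fun j => blockAvg (P := P) (j := j) expMeanLogSU) k U₀) c : SU N) : Matrix (Fin N) (Fin N) ℂ) =
      (toMS u k c.src : Matrix (Fin N) (Fin N) ℂ) *
        ((Averaging.iter (fun j => blockAvg (P := P) (j := j) expMeanLogSU) k U₀ c : SU N) : Matrix (Fin N) (Fin N) ℂ) *
        star (toMS u k c.tgt : Matrix (Fin N) (Fin N) ℂ) := by
    show ((toMS u k c.src * Averaging.iter (fun j => blockAvg (P := P) (j := j) expMeanLogSU) k U₀ c * (toMS u k c.tgt)⁻¹ : SU N) :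
      Matrix (Fin N) (Fin N) ℂ) = _
    rw [Submonoid.coe_mul, Submonoid.coe_mul, coe_inv_SU]
  simp only [qSkewOp_apply]
  rw [leftVel_gaugeAct_eq_rightVel u U₀ X, leftVel_eq_rightVel U₀ X,
    dIterL_gaugeAct_velField hk u h (fun b => specialUnitaryAd (U₀ b)⁻¹ (X b)) c, ← coeField_iter_eq_iterM k hu, ← coeField_iter_eq_iterM k h,
    coeField_apply, coeField_apply, iter_gaugeAct _ u U₀ k hk, hg, star_mul, star_mul, star_star, mul_smul_comm, smul_mul_assoc]
  congr 1
  have hb : star (toMS u k c.tgt : Matrix (Fin N) (Fin N) ℂ) * (toMS u k c.tgt : Matrix (Fin N) (Fin N) ℂ) = 1 := star_coe_mul_coe_SU (toMS u k c.tgt)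
  set a : Matrix (Fin N) (Fin N) ℂ := (toMS u k c.src : Matrix (Fin N) (Fin N) ℂ)
  set bb : Matrix (Fin N) (Fin N) ℂ := (toMS u k c.tgt : Matrix (Fin N) (Fin N) ℂ)
  set V : Matrix (Fin N) (Fin N) ℂ := ((Averaging.iter (fun j => blockAvg (P := P) (j := j) expMeanLogSU) k U₀ c : SU N) : Matrix (Fin N) (Fin N) ℂ)
  set W : Matrix (Fin N) (Fin N) ℂ :=
    dIterL k (coeField U₀) (fun b => (U₀ b : Matrix (Fin N) (Fin N) ℂ) * ((specialUnitaryAd (U₀ b)⁻¹ (X b) : lieSU (Fin N)) : Matrix (Fin N) (Fin N) ℂ)) c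
  calc a * W * star bb * (bb * (star V * star a)) = a * W * (star bb * bb) * star V * star a := by noncomm_ring
    _ = a * (W * star V) * star a := by rw [hb]; noncomm_ring

/-! ## §2  The `U(1)` line: background-independent and central -/

/-- ★ **THE PHASE LINE OF `Q_k(U₀)` IS THE FLAT ONE**: `qSkewOp k U₀ ((iθ)·1) c = qSkewOp k 1 ((iθ)·1) c` under the guard (dag-n07-e's ✓`dIterL_phase_eq_flat_mul` +
unitarity of `Ū^k(U₀)(c)`). [cite: Balaban1985Averaging, (11) p.19; Balaban1985BackgroundPropagators, (3.13) p.393] -/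
theorem qSkewOp_phase {k : ℕ} {U₀ : GaugeField P 0 (SU N)} (h : SmallBelow (fun j => blockAvg (P := P) (j := j) expMeanLogSU) k U₀)
    (θ : PBond P 0 → ℝ) (c : PBond P k) :
    qSkewOp k U₀ (fun b : PBond P 0 => ((((θ b : ℝ) : ℂ) * Complex.I)) • (1 : Matrix (Fin N) (Fin N) ℂ)) c =
      qSkewOp k (1 : GaugeField P 0 (SU N)) (fun b : PBond P 0 => ((((θ b : ℝ) : ℂ) * Complex.I)) • (1 : Matrix (Fin N) (Fin N) ℂ)) c := by
  have hdir : (fun b : PBond P 0 => ((((θ b : ℝ) : ℂ) * Complex.I)) • (1 : Matrix (Fin N) (Fin N) ℂ) * (U₀ b : Matrix (Fin N) (Fin N) ℂ)) =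
      fun b : PBond P 0 => ((((θ b : ℝ) : ℂ) * Complex.I)) • (U₀ b : Matrix (Fin N) (Fin N) ℂ) := by
    funext b
    rw [smul_mul_assoc, one_mul]
  rw [qSkewOp_one_apply]
  simp only [qSkewOp_apply]
  rw [hdir, dIterL_phase_eq_flat_mul h θ, ← coeField_iter_eq_iterM k h, coeField_apply, mul_assoc, coe_mul_star_coe_SU, mul_one]

/-- ★ **THE FLAT PHASE LINE IS CENTRAL**: `g · (qSkewOp k 1 ((iθ)·1) c) · g⋆ = qSkewOp k 1 ((iθ)·1) c` for every `g ∈ SU(N)` — the `linAvg` recursion commutes with the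
real-linear conjugation `X ↦ gXg⋆` (k0-s1-w1 ✓`linFamily_realLinear`), which fixes scalar fields. [cite: Balaban1985Averaging, (124)-(125) p.36] -/
theorem conj_qSkewOp_one_phase (k : ℕ) (g : SU N) (θ : PBond P 0 → ℝ) (c : PBond P k) :
    (g : Matrix (Fin N) (Fin N) ℂ) * qSkewOp k (1 : GaugeField P 0 (SU N)) (fun b : PBond P 0 => ((((θ b : ℝ) : ℂ) * Complex.I)) • (1 : Matrix (Fin N) (Fin N) ℂ)) c *
        star (g : Matrix (Fin N) (Fin N) ℂ) =
      qSkewOp k (1 : GaugeField P 0 (SU N)) (fun b : PBond P 0 => ((((θ b : ℝ) : ℂ) * Complex.I)) • (1 : Matrix (Fin N) (Fin N) ℂ)) c := by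
  obtain ⟨Q, hQ0, hQs⟩ := exists_linFamily (P := P) (n := Fin N)
  have hY : ∀ b : PBond P 0, star (((((θ b : ℝ) : ℂ) * Complex.I)) • (1 : Matrix (Fin N) (Fin N) ℂ)) = -(((((θ b : ℝ) : ℂ) * Complex.I)) • (1 : Matrix (Fin N) (Fin N) ℂ)) :=
    fun b => star_phase_smul_one (θ b)
  let φg : Matrix (Fin N) (Fin N) ℂ →ₗ[ℝ] Matrix (Fin N) (Fin N) ℂ :=
    ((LinearMap.mulLeft ℂ (g : Matrix (Fin N) (Fin N) ℂ)) ∘ₗ LinearMap.mulRight ℂ (star (g : Matrix (Fin N) (Fin N) ℂ))).restrictScalars ℝ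
  have hφ : ∀ X, φg X = (g : Matrix (Fin N) (Fin N) ℂ) * X * star (g : Matrix (Fin N) (Fin N) ℂ) := fun X => by
    simp [φg, mul_assoc]
  have hfix : (fun b : PBond P 0 => φg (((((θ b : ℝ) : ℂ) * Complex.I)) • (1 : Matrix (Fin N) (Fin N) ℂ))) =
      fun b : PBond P 0 => ((((θ b : ℝ) : ℂ) * Complex.I)) • (1 : Matrix (Fin N) (Fin N) ℂ) := by
    funext b
    rw [hφ, mul_smul_comm, mul_one, smul_mul_assoc, coe_mul_star_coe_SU]
  rw [qSkewOp_one_apply, (dIterL_one_apply_of_skew Q hQ0 hQs hY k).1, mul_smul_comm, smul_mul_assoc, ← hφ,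
    ← linFamily_realLinear Q hQ0 hQs φg _ k c, hfix]

/-! ## §3  Every skew-Hermitian direction, and the complexified operator -/

/-- ★★ **GAUGE COVARIANCE OF `qSkewOp` ON ALL SKEW-HERMITIAN DIRECTIONS** (`𝔲(N) = 𝔰𝔲(N) ⊕ iℝ·1`: §1 on the traceless part, §2 on the phase line).
[cite: Balaban1985BackgroundPropagators, (3.32) p.396] -/
theorem qSkewOp_gaugeAct_skew {k : ℕ} (hk : k ≤ P.m + P.K) (u : GaugeTransf P 0 (SU N)) {U₀ : GaugeField P 0 (SU N)}
    (h : SmallBelow (fun j => blockAvg (P := P) (j := j) expMeanLogSU) k U₀) {Y : PBond P 0 → Matrix (Fin N) (Fin N) ℂ} (hY : ∀ b, star (Y b) = -Y b)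
    (c : PBond P k) :
    qSkewOp k (gaugeAct u U₀) (fun b : PBond P 0 => (u b.src : Matrix (Fin N) (Fin N) ℂ) * Y b * star (u b.src : Matrix (Fin N) (Fin N) ℂ)) c =
      (toMS u k c.src : Matrix (Fin N) (Fin N) ℂ) * qSkewOp k U₀ Y c * star (toMS u k c.src : Matrix (Fin N) (Fin N) ℂ) := by
  have hu := smallBelow_gaugeAct hk u h
  -- split `Y = Y₀ + (iθ)·1`
  set θ : PBond P 0 → ℝ := fun b => (Matrix.trace (Y b)).im / N with hθ
  set X : PBond P 0 → lieSU (Fin N) := fun b => ⟨Y b - ((((θ b : ℝ) : ℂ) * Complex.I)) • (1 : Matrix (Fin N) (Fin N) ℂ), sub_phase_mem_lieSU (hY b)⟩ with hX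
  have hYsplit : Y = (fun b : PBond P 0 => (X b : Matrix (Fin N) (Fin N) ℂ)) + fun b : PBond P 0 => ((((θ b : ℝ) : ℂ) * Complex.I)) • (1 : Matrix (Fin N) (Fin N) ℂ) := by
    funext b
    simp [hX]
  have hAdsplit : (fun b : PBond P 0 => (u b.src : Matrix (Fin N) (Fin N) ℂ) * Y b * star (u b.src : Matrix (Fin N) (Fin N) ℂ)) =
      (fun b : PBond P 0 => ((specialUnitaryAd (u b.src) (X b) : lieSU (Fin N)) : Matrix (Fin N) (Fin N) ℂ)) +
        fun b : PBond P 0 => ((((θ b : ℝ) : ℂ) * Complex.I)) • (1 : Matrix (Fin N) (Fin N) ℂ) := by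
    funext b
    rw [Pi.add_apply, coe_specialUnitaryAd]
    have hb : Y b = (X b : Matrix (Fin N) (Fin N) ℂ) + ((((θ b : ℝ) : ℂ) * Complex.I)) • (1 : Matrix (Fin N) (Fin N) ℂ) := congrFun hYsplit b
    rw [hb, mul_add, add_mul, mul_smul_comm, mul_one, smul_mul_assoc, coe_mul_star_coe_SU]
  rw [hAdsplit, map_add, Pi.add_apply, qSkewOp_gaugeAct_su hk u h X c, qSkewOp_phase hu θ c]
  conv_rhs => rw [hYsplit, map_add, Pi.add_apply, mul_add, add_mul, qSkewOp_phase h θ c, conj_qSkewOp_one_phase k (toMS u k c.src) θ c]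

omit [NeZero N] in
/-- The skew part commutes with unitary conjugation: `𝔞(gZg⋆) = g·𝔞Z·g⋆`. [cite: Balaban1985BackgroundPropagators, p.393 (bookkeeping)] -/
theorem skewField_conj {ι : Type*} (g : ι → SU N) (Z : ι → Matrix (Fin N) (Fin N) ℂ) :
    skewField (fun b => (g b : Matrix (Fin N) (Fin N) ℂ) * Z b * star (g b : Matrix (Fin N) (Fin N) ℂ)) =
      fun b => (g b : Matrix (Fin N) (Fin N) ℂ) * skewField Z b * star (g b : Matrix (Fin N) (Fin N) ℂ) := by
  funext b
  simp only [skewField_apply, Matrix.conjTranspose_mul, Matrix.conjTranspose_conjTranspose, Matrix.star_eq_conjTranspose, mul_sub, sub_mul,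
    mul_smul_comm, smul_mul_assoc, mul_assoc]

/-- ★★ **GAUGE COVARIANCE OF THE COMPLEXIFIED `Q_k(U₀)` (def-Y's `qCplxOp`)**: under the guard below `k ≤ m + K`, for EVERY matrix field `Z`,
`qCplxOp k U₀^u (b ↦ u(b₋)·Z_b·u(b₋)⋆) c = ū(c₋)·(qCplxOp k U₀ Z c)·ū(c₋)⋆` — print's (3.32) for the pinned letter. [cite: Balaban1985BackgroundPropagators, (3.32) p.396, (3.13) p.393] -/
theorem qCplxOp_gaugeAct {k : ℕ} (hk : k ≤ P.m + P.K) (u : GaugeTransf P 0 (SU N)) {U₀ : GaugeField P 0 (SU N)}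
    (h : SmallBelow (fun j => blockAvg (P := P) (j := j) expMeanLogSU) k U₀) (Z : PBond P 0 → Matrix (Fin N) (Fin N) ℂ) (c : PBond P k) :
    qCplxOp k (gaugeAct u U₀) (fun b : PBond P 0 => (u b.src : Matrix (Fin N) (Fin N) ℂ) * Z b * star (u b.src : Matrix (Fin N) (Fin N) ℂ)) c =
      (toMS u k c.src : Matrix (Fin N) (Fin N) ℂ) * qCplxOp k U₀ Z c * star (toMS u k c.src : Matrix (Fin N) (Fin N) ℂ) := by
  have hconj : (-Complex.I • fun b : PBond P 0 => (u b.src : Matrix (Fin N) (Fin N) ℂ) * Z b * star (u b.src : Matrix (Fin N) (Fin N) ℂ)) =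
      fun b : PBond P 0 => (u b.src : Matrix (Fin N) (Fin N) ℂ) * (-Complex.I • Z) b * star (u b.src : Matrix (Fin N) (Fin N) ℂ) := by
    funext b
    simp only [Pi.smul_apply, mul_smul_comm, smul_mul_assoc]
  unfold qCplxOp
  rw [cplxOp_apply, cplxOp_apply, hconj, skewField_conj (fun b : PBond P 0 => u b.src) Z, skewField_conj (fun b : PBond P 0 => u b.src) (-Complex.I • Z),
    Pi.add_apply, Pi.smul_apply, Pi.add_apply, Pi.smul_apply,
    qSkewOp_gaugeAct_skew hk u h (fun b => by rw [Matrix.star_eq_conjTranspose]; exact skewField_conjTranspose Z b) c,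
    qSkewOp_gaugeAct_skew hk u h (fun b => by rw [Matrix.star_eq_conjTranspose]; exact skewField_conjTranspose (-Complex.I • Z) b) c,
    mul_add, add_mul, mul_smul_comm, smul_mul_assoc]

/-! ## §4  At the record, in def-Y's slot types: `Q(U^u) R(u) = R(ū) Q(U)` -/

section Record

open B9Eq328GaugeAction (gaugeW equiv_gaugeW_eq AdW_apply)

variable (F : T4Family) (N) {K : ℕ} (k : ℕ)

/-- ★★★ **[B9] (3.32) FOR THE PINNED LETTER `QOfRecord`**: under the record's guard below `k ≤ m + K`, for every gauge transformation `u` of the fine torus and every `x`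
in the lit bond carrier, `QOfRecord F N k (u • U₀) (R(u)x) = R(ū)(QOfRecord F N k U₀ x)`, where `R(u)` = `gaugeW phiRec` acting by `Ad_{u(b₋)}` on the fine bonds (read through
`bondToLit`) and `R(ū)` by `Ad_{ū(c₋)}`, `ū = u ∘ embIter k`, on the record's level-`k` bonds. [cite: Balaban1985BackgroundPropagators, (3.28)-(3.32) pp.395-396; Balaban1985Variational, (44) p.285] -/
theorem QOfRecord_gaugeAct (hk : k ≤ (F.P K).m + (F.P K).K) (u : GaugeTransf (F.P K) 0 (SU N)) {U₀ : GaugeField (F.P K) 0 (SU N)}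
    (h : SmallBelow (avOfRecord F N K) k U₀) (x : B11Eq103H1Complex.BondL2K ℂ (F.P K).d (fun _ => (F.P K).sitesPerDir 0) (c0Rec F K k) (WRec N)) :
    QOfRecord F N k (gaugeAct u U₀)
        (gaugeW (phiRec N) (fun a : B9SectCLatticeCarrier.Bond (F.P K).d (fun _ => (F.P K).sitesPerDir 0) =>
          suToUnits N (u ((bondToLit (F.P K) 0).symm a).src)) x) =
      gaugeW (phiRec N) (fun c : PBond (F.P K) k => suToUnits N (toMS u k c.src)) (QOfRecord F N k U₀ x) := by
  apply (WL2.equiv ℂ (wBRec F K k) (WRec N)).injective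
  funext c
  have hin : bondFieldIn F N k (gaugeW (phiRec N) (fun a : B9SectCLatticeCarrier.Bond (F.P K).d (fun _ => (F.P K).sitesPerDir 0) =>
      suToUnits N (u ((bondToLit (F.P K) 0).symm a).src)) x) =
      fun b : PBond (F.P K) 0 => (u b.src : Matrix (Fin N) (Fin N) ℂ) * bondFieldIn F N k x b * star (u b.src : Matrix (Fin N) (Fin N) ℂ) := by
    funext b
    simp only [bondFieldIn_apply, equiv_gaugeW_eq, AdW_apply, Equiv.symm_apply_apply, coe_suToUnits, coe_suToUnits_inv, coe_inv_SU,
      LinearEquiv.apply_symm_apply]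
  rw [QOfRecord_apply, hin, qCplxOp_gaugeAct hk u h (bondFieldIn F N k x) c]
  simp only [equiv_gaugeW_eq, AdW_apply, QOfRecord_apply, LinearEquiv.apply_symm_apply, coe_suToUnits, coe_suToUnits_inv, coe_inv_SU]

end Record

end Summit.QuantumFields.YangMills.Theorems.N07QOfRecordGaugeCovariance

end
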